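import Summits.BirchSwinnertonDyer.BirchSwinnertonDyer.Theorems.KatoDescentPotSupersingularASideLedgerClassical
import Summits.BirchSwinnertonDyer.BirchSwinnertonDyer.Theorems.KatoDescentPotSupersingularASideZetaLineSaturation
import HarnessLib

/-!
# The A⊕S ledger of crux M in classical invariants, with brick (b) consumed in COUNTING form:
# `p^N ∣ [B_k(ℤ_p y₀) : B_k(ℤ_p y₀) ⊓ 𝓚_k^⊥]` in place of the zeta-line saturation `ℤ_p y₀ ∩ f_k⁻¹(𝓚_k^⊥) ⊆ p^N ℤ_p y₀`
# (route `KatoDescentPotSupersingular` / `…Tame…`, crux M = stmt-BirchSwinnertonDyer-19196; route-free helper)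

Seat `bsd-potss-rkm` g20 (prover; cell `bsd-potss`), item stmt-BirchSwinnertonDyer-19196 (`--supports … --as helper`; closes nothing).
HONEST FRAMING: BSD is not proved by any of this; nothing is booked; theorems only (no definition, no named fact).

## What

Part 50 (`exists_forall_aSide_le_classical`) carries brick (b) (Kato Lemma 14.18 + the value of the dual exponential) as the SUBGROUP statement
`hY : ℤ_p y₀ ∩ f_k⁻¹(𝓚_k^⊥) ⊆ p^N ℤ_p y₀`.  Part 51 (`ASideJunction.exists_mem_smul_eq_of_pow_dvd_relIndex`) derives `hY` from the COUNT
`p^N ∣ [ℤ_p y₀ : ℤ_p y₀ ∩ f_k⁻¹(𝓚_k^⊥)] = [B_k(ℤ_p y₀) : B_k(ℤ_p y₀) ⊓ 𝓚_k^⊥]` as soon as the target of `f_k` is killed by a power of `p` — here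
`H¹(ℚ_p, E[p^k]^D(p^j p^k))` is killed by `p^j p^k` (`TateDual.nsmul_eq_zero`).  Hence:

* **`exists_forall_aSide_le_classical_of_dvd`** — part 50 verbatim with `hY` replaced by `p ^ N ∣ [B_k(ℤ_p y₀) : B_k(ℤ_p y₀) ⊓ 𝓚_k^⊥]` (the same
  index that appears in the conclusion):
  `p^{v_p(Tam W)} · #Ш(W)[p^∞] · [B_k(ℤ_p y₀) : B_k(ℤ_p y₀) ⊓ 𝓚_k^⊥] · [A : ℤ_p y₀] ≤ p^{v_p(c_p)} · (#Sel_str^{ur} · p^k · #W(ℚ)[p^k] · #W(ℚ)[p^N])`.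

So brick (b) is consumed as ONE number per level: `r_k := [B_k(ℤ_p y₀) : B_k(ℤ_p y₀) ⊓ 𝓚_k^⊥]` (`= p^{k−e}` by Kato Lemma 14.18 with the value of
`exp*`, `e = a + v_p(λ(0)) + t_p − v_p(c_p)`); by the perfect-pairing count of part 32 (`natCard_inf_annLeft_mul_relIndex`) the same number is
`#𝓚_k / #(𝓚_k ⊓ {}^⊥B_k(ℤ_p y₀))` — the local Tate pairing of `red_k y₀` against the Kummer classes of `W(ℚ_p)`, which is what an explicit
reciprocity law computes.  With `r_k = p^{k−e}` and `N ≤ k − e` the displayed inequality is the `count` clause of `MemberHullZetaInputs` modulo (c2′)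
(module docstrings of parts 49–50).

References: K. Kato, Astérisque 295 (2004), §14.8, (14.9.3), Prop. 14.16 and its proof (pp. 238–245), Lemma 14.18 (pp. 247–248) [Kato2004Asterisque];
J. S. Milne, *ADT* I Cor. 2.3, Thm. 2.8, Lemma 3.3 [MilneADT2006].
-/

-- the summit and its single problem are both named `BirchSwinnertonDyer` (registry layout D-0017)
set_option linter.dupNamespace false
set_option autoImplicit false

noncomputable section

open scoped Classical ContRepresentation NumberField AddSubgroup
open CategoryTheory Function Field NumberField IsDedekindDomain WeierstrassCurve
open Literature.NumberTheory.EllipticCurves Literature.NumberTheory.GaloisRepresentations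
  Literature.NumberTheory.GaloisRepresentations.DiscreteGaloisModule Literature.NumberTheory.GaloisCohomology
open Literature.NumberTheory.EllipticCurves.Kato2004 Literature.NumberTheory.EllipticCurves.Kato2004.EulerSystemValues
open Summit.BirchSwinnertonDyer.Rank1Residual.X11b.Levels Summit.BirchSwinnertonDyer.Rank1Residual.X11b.LocBridge
  Summit.BirchSwinnertonDyer.Rank1Residual.X11b.LevelKummer Summit.BirchSwinnertonDyer.Rank1Residual.X11b.FiniteDuality
  Summit.BirchSwinnertonDyer.Rank1Residual.X11b.AcSelmer
open Summit.BirchSwinnertonDyer.Rank1Residual.GaloisImage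
open Summit.BirchSwinnertonDyer.BirchSwinnertonDyer.Theorems.KummerTowerOrthogonal
open Summit.BirchSwinnertonDyer.BirchSwinnertonDyer.Theorems.ASideJunction

namespace Summit.BirchSwinnertonDyer.BirchSwinnertonDyer.Theorems.KatoFiniteLevelCount

section ClassicalOfDvd

variable (W : WeierstrassCurve ℚ) [W.IsElliptic] (p : ℕ) [Fact p.Prime] [ContinuousSMul ℤ_[p] (W.tateModule p)]
  (𝓤inf 𝓢inf : SelmerStructure (primaryGaloisModule W p))

/-- **THE A⊕S LEDGER IN CLASSICAL INVARIANTS WITH BRICK (b) IN COUNTING FORM**: as `exists_forall_aSide_le_classical` (part 50), the zeta-line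
saturation replaced by `p^N ∣ [B_k(ℤ_p y₀) : B_k(ℤ_p y₀) ⊓ 𝓚_k^⊥]` (part 51 + `p^j p^k · H¹(ℚ_p, E[p^k]^D) = 0`):
`p^{v_p(Tam W)} · #Ш(W)[p^∞] · [B_k(ℤ_p y₀) : B_k(ℤ_p y₀) ⊓ 𝓚_k^⊥] · [A : ℤ_p y₀] ≤ p^{v_p(c_p)} · (#Sel_str^{ur} · p^k · #W(ℚ)[p^k] · #W(ℚ)[p^N])`.
[cite: Kato2004Asterisque, §14.8 (p. 238), (14.9.3) (p. 240), Prop. 14.16 and its proof (pp. 244–245), Lemma 14.18 (pp. 247–248)]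
[cite: MilneADT2006, Ch. I, Cor. 2.3, Lemma 3.3] -/
theorem exists_forall_aSide_le_classical_of_dvd (hodd : p ≠ 2) (T : Finset (HeightOneSpectrum (𝓞 ℚ)))
    (hpT : primePlace p ∈ T) (hT : ∀ v : HeightOneSpectrum (𝓞 ℚ), v ∉ T → W.HasGoodReductionAt v)
    [Finite W.toAffine.Point] [Finite (AddCommGroup.primaryComponent (↥W.sha) p)]
    (hUp : 𝓤inf (Sum.inr (primePlace p)) = ⊤)
    (hUur : ∀ v : HeightOneSpectrum (𝓞 ℚ), v ≠ primePlace p →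
      𝓤inf (Sum.inr v) = unramifiedSubgroup (GaloisRep.toLocal v (primaryGaloisModule W p)) 1)
    (hUinl : ∀ w : InfinitePlace ℚ, 𝓤inf (Sum.inl w) = ⊤)
    (hSp : 𝓢inf (Sum.inr (primePlace p)) = ⊥)
    (hSur : ∀ v : HeightOneSpectrum (𝓞 ℚ), v ≠ primePlace p →
      𝓢inf (Sum.inr v) = unramifiedSubgroup (GaloisRep.toLocal v (primaryGaloisModule W p)) 1)
    (hSinl : ∀ w : InfinitePlace ℚ, 𝓢inf (Sum.inl w) = ⊤)
    (y₀ : H1 (tateRep W p) ⊤) (hy₀ : y₀ ∈ integralH1 (tateRep W p) p ⊤) (N : ℕ)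
    (hN : ∀ a ∈ integralH1 (tateRep W p) p ⊤, ((p ^ N : ℕ) : ℤ) • a ∈ (ℤ_[p] ∙ y₀).toAddSubgroup) :
    ∃ j s k₀ : ℕ, ∀ k : ℕ, k₀ ≤ k →
      haveI := neZero_pow p j; haveI := neZero_pow p s; haveI := neZero_pow p k
      haveI : Finite (geomTorsion W ((p ^ k : ℕ) : ℤ)) := finite_geomTorsion_pow W p k
      haveI : Finite (geomTorsion W ((p ^ s * p ^ k : ℕ) : ℤ)) :=
        W.finite_torsionPoints_holds (AlgebraicClosure ℚ) (Int.natCast_ne_zero.mpr (NeZero.ne (p ^ s * p ^ k)))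
      ∀ (inv : LocalInvariants ℚ (p ^ j * p ^ k)), inv.SumLocalTermEqZero → inv.IsPerfect →
      ∀ (ε : geomTorsion W ((p ^ j * p ^ k : ℕ) : ℤ) → geomTorsion W ((p ^ j * p ^ k : ℕ) : ℤ) → AlgebraicClosure ℚ)
        (hμ : ∀ S T, ε S T ^ (p ^ j * p ^ k) = 1)
        (hadd₁ : ∀ S₁ S₂ T, ε (S₁ + S₂) T = ε S₁ T * ε S₂ T)
        (hadd₂ : ∀ S T₁ T₂, ε S (T₁ + T₂) = ε S T₁ * ε S T₂)
        (hgal : ∀ (σ : absoluteGaloisGroup ℚ) (S T : geomTorsion W ((p ^ j * p ^ k : ℕ) : ℤ)), σ • ε S T = ε (σ • S) (σ • T)),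
      -- brick (b) in COUNTING form at level `k` (displayed, not proved): `p^N ∣ [B_k(ℤ_p y₀) : B_k(ℤ_p y₀) ⊓ 𝓚_k^⊥]`
      p ^ N ∣ ((((ℤ_[p] ∙ y₀).toAddSubgroup.map
                  (((galoisCohomology.map (W.torsionInclusion (intPow_dvd_natCast_pow p k)) 1).comp
                      (ofTopSubgroup (W.torsionGaloisModule ((p : ℤ) ^ k)).toTopRep 1).hom.toLinearMap.toAddMonoidHom).comp
                    (reduceH1Pk W p k ⊤))).map
                  (galoisCohomology.map (DiscreteGaloisModule.pairingDualIntertwining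
                    (ρ₁ := W.torsionGaloisModule ((p ^ k : ℕ) : ℤ)) (ρ₂ := W.torsionGaloisModule ((p ^ k : ℕ) : ℤ))
                    (B := descendHom W (p ^ j) (p ^ k) ε hμ hadd₁ hadd₂)
                    (descendHom_smul W (p ^ j) (p ^ k) ε hμ hadd₁ hadd₂ hgal)) 1)).map
                (galoisCohomology.localization ((W.torsionGaloisModule ((p ^ k : ℕ) : ℤ)).tateDual (p ^ j * p ^ k))
                  (Sum.inr (primePlace p)) 1) ⊓
              annRight (localTatePairingZMod (W.torsionGaloisModule ((p ^ k : ℕ) : ℤ)) (p ^ j * p ^ k)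
                (Sum.inr (primePlace p)) (inv (Sum.inr (primePlace p))))
                (W.kummerSelmerStructure ((p ^ k : ℕ) : ℤ) (Sum.inr (primePlace p)))).relIndex
              ((((ℤ_[p] ∙ y₀).toAddSubgroup.map
                  (((galoisCohomology.map (W.torsionInclusion (intPow_dvd_natCast_pow p k)) 1).comp
                      (ofTopSubgroup (W.torsionGaloisModule ((p : ℤ) ^ k)).toTopRep 1).hom.toLinearMap.toAddMonoidHom).comp
                    (reduceH1Pk W p k ⊤))).map
                  (galoisCohomology.map (DiscreteGaloisModule.pairingDualIntertwining
                    (ρ₁ := W.torsionGaloisModule ((p ^ k : ℕ) : ℤ)) (ρ₂ := W.torsionGaloisModule ((p ^ k : ℕ) : ℤ))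
                    (B := descendHom W (p ^ j) (p ^ k) ε hμ hadd₁ hadd₂)
                    (descendHom_smul W (p ^ j) (p ^ k) ε hμ hadd₁ hadd₂ hgal)) 1)).map
                (galoisCohomology.localization ((W.torsionGaloisModule ((p ^ k : ℕ) : ℤ)).tateDual (p ^ j * p ^ k))
                  (Sum.inr (primePlace p)) 1)) →
      ∀ (e : geomTorsion W ((p ^ s * p ^ k : ℕ) : ℤ) → geomTorsion W ((p ^ s * p ^ k : ℕ) : ℤ) → AlgebraicClosure ℚ)
        (hμ' : ∀ S T, e S T ^ (p ^ s * p ^ k) = 1)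
        (hadd₁' : ∀ S₁ S₂ T, e (S₁ + S₂) T = e S₁ T * e S₂ T)
        (hadd₂' : ∀ S T₁ T₂, e S (T₁ + T₂) = e S T₁ * e S T₂)
        (hgal' : ∀ (σ : absoluteGaloisGroup ℚ) (S T : geomTorsion W ((p ^ s * p ^ k : ℕ) : ℤ)), σ • e S T = e (σ • S) (σ • T)),
        (∀ P, e P P = 1) → (∀ P, (∀ Q, e Q P = 1) → P = 0) →
      ∀ (inv' : LocalInvariants ℚ (p ^ s * p ^ k)), inv'.IsPerfect → inv'.SelmerComplement →
      p ^ padicValNat p W.tamagawaProduct * Nat.card (AddCommGroup.primaryComponent (↥W.sha) p) *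
            ((((ℤ_[p] ∙ y₀).toAddSubgroup.map
                  (((galoisCohomology.map (W.torsionInclusion (intPow_dvd_natCast_pow p k)) 1).comp
                      (ofTopSubgroup (W.torsionGaloisModule ((p : ℤ) ^ k)).toTopRep 1).hom.toLinearMap.toAddMonoidHom).comp
                    (reduceH1Pk W p k ⊤))).map
                  (galoisCohomology.map (DiscreteGaloisModule.pairingDualIntertwining
                    (ρ₁ := W.torsionGaloisModule ((p ^ k : ℕ) : ℤ)) (ρ₂ := W.torsionGaloisModule ((p ^ k : ℕ) : ℤ))
                    (B := descendHom W (p ^ j) (p ^ k) ε hμ hadd₁ hadd₂)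
                    (descendHom_smul W (p ^ j) (p ^ k) ε hμ hadd₁ hadd₂ hgal)) 1)).map
                (galoisCohomology.localization ((W.torsionGaloisModule ((p ^ k : ℕ) : ℤ)).tateDual (p ^ j * p ^ k))
                  (Sum.inr (primePlace p)) 1) ⊓
              annRight (localTatePairingZMod (W.torsionGaloisModule ((p ^ k : ℕ) : ℤ)) (p ^ j * p ^ k)
                (Sum.inr (primePlace p)) (inv (Sum.inr (primePlace p))))
                (W.kummerSelmerStructure ((p ^ k : ℕ) : ℤ) (Sum.inr (primePlace p)))).relIndex
              ((((ℤ_[p] ∙ y₀).toAddSubgroup.map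
                  (((galoisCohomology.map (W.torsionInclusion (intPow_dvd_natCast_pow p k)) 1).comp
                      (ofTopSubgroup (W.torsionGaloisModule ((p : ℤ) ^ k)).toTopRep 1).hom.toLinearMap.toAddMonoidHom).comp
                    (reduceH1Pk W p k ⊤))).map
                  (galoisCohomology.map (DiscreteGaloisModule.pairingDualIntertwining
                    (ρ₁ := W.torsionGaloisModule ((p ^ k : ℕ) : ℤ)) (ρ₂ := W.torsionGaloisModule ((p ^ k : ℕ) : ℤ))
                    (B := descendHom W (p ^ j) (p ^ k) ε hμ hadd₁ hadd₂)
                    (descendHom_smul W (p ^ j) (p ^ k) ε hμ hadd₁ hadd₂ hgal)) 1)).map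
                (galoisCohomology.localization ((W.torsionGaloisModule ((p ^ k : ℕ) : ℤ)).tateDual (p ^ j * p ^ k))
                  (Sum.inr (primePlace p)) 1)) *
            ((ℤ_[p] ∙ y₀).toAddSubgroup.relIndex (integralH1 (tateRep W p) p ⊤).toAddSubgroup) ≤
        p ^ padicValNat p ((W.baseChange ((primePlace p).adicCompletion ℚ)).localTamagawaNumber
            ((primePlace p).adicCompletionIntegers ℚ)) *
          (Nat.card 𝓢inf.selmerGroup * p ^ k * Nat.card ↥(W.toAffine.Point[((p ^ k : ℕ) : ℤ)]) *
            Nat.card ↥(W.toAffine.Point[((p ^ N : ℕ) : ℤ)]))  := by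
  obtain ⟨j, s, k₀, hA⟩ := exists_forall_aSide_le_classical W p 𝓤inf 𝓢inf hodd T hpT hT hUp hUur hUinl hSp hSur hSinl y₀ hy₀ N hN
  refine ⟨j, s, k₀, fun k hk => ?_⟩
  intro inv hsum hperf ε hμ hadd₁ hadd₂ hgal hdvd e hμ' hadd₁' hadd₂' hgal' halt hnondeg inv' hperf' hcompl'
  haveI := neZero_pow p j; haveI := neZero_pow p k
  haveI : Finite (geomTorsion W ((p ^ k : ℕ) : ℤ)) := finite_geomTorsion_pow W p k
  -- the count as an index in `H¹(ℚ, T_pE)`: `p^N ∣ [Y : Y ⊓ f_k⁻¹(𝓚_k^⊥)]`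
  simp only [AddSubgroup.map_map] at hdvd
  rw [relIndex_map_inf_eq_relIndex_comap] at hdvd
  -- the target of `f_k` is killed by `p^j p^k`
  have hB : ∀ y : galoisCohomology (((W.torsionGaloisModule ((p ^ k : ℕ) : ℤ)).tateDual (p ^ j * p ^ k)).toLocal
      (Sum.inr (primePlace p))) 1, (p ^ j * p ^ k) • y = 0 :=
    galoisCohomology.nsmul_eq_zero_of_forall _ fun f => DiscreteGaloisModule.TateDual.nsmul_eq_zero f
  have hcast : ∀ c : ℤ_[p], ((p : ℤ_[p]) ^ (j + k) * c) • y₀ = (p ^ j * p ^ k) • (c • y₀) := fun c => by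
    rw [mul_smul, ← Nat.cast_smul_eq_nsmul ℤ_[p] (p ^ j * p ^ k), Nat.cast_mul, Nat.cast_pow, Nat.cast_pow, pow_add]
  have hsat := exists_mem_smul_eq_of_pow_dvd_relIndex y₀ _ (j + k) (fun c => by
    rw [AddSubgroup.mem_comap, hcast c, map_nsmul, hB]; exact AddSubgroup.zero_mem _) N hdvd
  exact hA k hk inv hsum hperf ε hμ hadd₁ hadd₂ hgal (fun y hy hfy => hsat y hy (AddSubgroup.mem_comap.mpr hfy))
    e hμ' hadd₁' hadd₂' hgal' halt hnondeg inv' hperf' hcompl'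

end ClassicalOfDvd

end Summit.BirchSwinnertonDyer.BirchSwinnertonDyer.Theorems.KatoFiniteLevelCount

end
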